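import Mathlib.Analysis.SpecialFunctions.Log.Deriv
import Mathlib.Analysis.SpecialFunctions.Pow.Real

/-!
# EriceRemainderEnclosureHistoryAutonomyComparisonKernelEnergy — THE SYMMETRIC-KERNEL (ENERGY) METHOD FOR (E58b)'s PROFILE CONDITION: for ANY
# non-negative kernel `a`, weights `L ≥ 0`, reads `P_i = Σ_k L_k a_ik` and loads `f_i = L_i∕P_i`, the PERRON SANDWICH `Σ_{i,j} √(a_ij a_ji)·f_i f_j ≤ Σ_j f_j`
# (AM–GM), so `Σ_j f_j ≤ 1∕m` for every copositivity constant `m` of the geometric kernel `√(a_ij a_ji)` on the support; the LINE LEMMA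
# `Σ_{ij} f_i f_j |w_i − w_j| ≤ h·(Σf)²` (points in an interval of half-length `h`) turns every AFFINE MINORANT `√(a_ij a_ji) ≥ ρ′ − λ|w_i − w_j|` in a
# line coordinate into `m ≥ ρ′ − λh`; and for the AGE KERNEL `s_jk = √(j∕(j+k))` the geometric read `σ(t) = t^{1∕4}∕√(1+t)` of two ages at ratio `t`
# satisfies **`σ(t) ≥ ρ·(1 − (log t)∕8)` for all `t ≥ 1`** (`ρ = √(1∕2)`; artanh series + a degree-9 Bernstein certificate) — the inputs of the
# window theorem `…ComparisonWindowHundred` («all ages within a factor `e^{8(2−√2)} ≈ 108` pass the profile condition»)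

Cell `pub-balaban`, β-function sub-cell, BINDER row D4 «RemainderConst leaves for Bałaban's split» (`HOME/BINDER-OWNERS.md`; owner lineage `b2b-balaban-beta-an4`;
this file by co-owner #3 lineage `b2b-balaban-beta-d4-p3`, generation 101, road P3), β-FLOW TEAM duty (1), FREEZE (0) honoured (def-free; Mathlib only:
`Real.hasSum_log_sub_log_of_abs_lt_one`, `sum_le_hasSum`, `two_mul_le_add_sq`, `Finset.sum_mul_sum` BY NAME; nothing restated).  Sequel of (E58b)
`…ComparisonAffineProfile` (co-owner #2, the profile condition `Σ_j L_j∕P_j ≤ 2`), (E63e) `…ComparisonWindowSeven` (factor `7` by a Riemann sum) and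
(P3·T1a∕b) `…ComparisonThreeAgesReads∕Near` (this lineage, gen 100: three ages within `36` by a ten-coefficient cubic), and the answer to gen 100's
WINDOW CONJECTURE (E58b-W) (`HOME/b2b-balaban-beta-d4-p3/g100/WINDOW-FRONTIER.md`: «every profile on a window of ratio `R ≤ 133` passes») up to `R ≈ 108`.

HONEST FRAMING (page 1, verbatim and binding).  *"Discharging BetaPertH makes Bałaban's UV stability UNCONDITIONAL — a real constructive-QFT result; it is
NOT the continuum limit and NOT the Clay problem."*  THIS FILE DISCHARGES NOTHING OF THE KIND.  Elementary real analysis (finite sums, `√`, `log`) about the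
cell's own NOT-IN-PRINT comparison binder (conjecture (E58′)); the age profile of Bałaban's (1.22) limit functional is NOT PRINTED ([I] p. 298; GAPS
G-t4-U2-1∕-2) and NOT asserted.  Row D4 class UNCHANGED (critical-path width 0; instance 0∕1; D4 DISCHARGE NO DATE).  HONEST DEPENDENCY: continuum YM on
T⁴ ⇐ BetaPertH ∧ nine spine estimates (0/9 proved); BetaPertH ⇐ (D1) ∧ (D4) ∧ CAP+tail; G-an2-4 gates asym, D1 and NE2/3/4.

THE POINT (census sense (α); the COMPARISON column).  (E58b): `Σ_{j<K} L_j∕P_j ≤ 2`, `P_j = Σ_{k<K} L_k·√(j∕(j+k))`, suffices for comparison at any size.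
The substitution `L_k = k^{1∕4}·X_k` SYMMETRISES the reads: `L_j∕P_j = X_j∕(σX)_j` with `σ_jk = s_jk·(k∕j)^{1∕4} = (jk)^{1∕4}∕√(j+k) = √(s_jk·s_kj)` —
symmetric, diagonal `ρ = 1∕√2`, a function `ψ(u) = (2·cosh(u∕2))^{−1∕2}` of `u = log k − log j` alone.  §1: for the loads `f_j = L_j∕P_j` of ANY kernel,
`2σ_ij∕(P_iP_j) ≤ s_ij∕P_i² + s_ji∕P_j²` (AM–GM) summed against `L_iL_j` gives **`Σ_{ij} σ_ij f_i f_j ≤ Σ_j f_j`** (`energy_le_sum`; equivalently: the loads'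
vector is the Perron eigenvector of `diag(f)·σ`, so `fᵀσf ≤ Σf`).  Hence **`Σ_j f_j ≤ 1∕m` whenever `fᵀσf ≥ m·(Σf)²` on the support** — the profile sum is
at most the reciprocal of the MINIMAL σ-ENERGY of a probability vector on the age set (for two ages at log-distance `ℓ` this is `2∕(ψ(0) + ψ(ℓ))`, the
exact two-point supremum `2∕(ρ + R^{1∕4}∕√(1+R))` of gen 100's memo: the method is sharp there).  §2: energy from an affine minorant in a line
coordinate — `h|α − β| + αβ ≤ h²` on `[−h, h]` (`mul_abs_sub_add_mul_le`) summed against `f_if_j` gives **`Σ_{ij} f_if_j|w_i − w_j| ≤ h(Σf)²`**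
(`sum_mul_abs_sub_le`: the two endpoints are extremal), so `σ_ij ≥ ρ′ − λ|w_i − w_j|` on a window of half-length `h` yields `m ≥ ρ′ − λh`
(**`sum_div_le_inv_of_affine_minorant`**, stated for an arbitrary finite index type and kernel).  §3: for the age kernel in the coordinate `w = log k`,
**`σ(t) = t^{1∕4}∕√(1+t) ≥ ρ(1 − (log t)∕8)` for ALL `t ≥ 1`** (`sqrt_half_mul_le_sqrt_geomRead`, `sqrt_half_mul_le_geomRead`): with `z = t^{1∕4}`,
`y = (z−1)∕(z+1)`, two terms of the artanh series give `log t = 4·log z ≥ 8y + (8∕3)y³` (`two_terms_le_log`), so `1 − (log t)∕8 ≤ q := 1 − y − y³∕3`; for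
`q > 0` one has `y ≤ 41∕50` and `½q² ≤ z²∕(1+z⁴) = (1−y²)²∕(2(1+6y²+y⁴))` is `y·G(y) ≥ 0` with `G = 18 − 81y + 114y² − 60y³ + 54y⁴ − 46y⁵ + 6y⁶ − 12y⁷ − y⁹`,
whose Bernstein coefficients on `[0,.49]`, `[.49,.5]`, `[.5,.82]` are all `≥ 0.43` (`poly_cert_nonneg`, three `linarith` calls).  The slope `ρ∕8` is
`≈ 3 %` above the critical tangent slope `0.1211·ρ` of `ψ` from `(0, ρ)` (touching at `t ≈ 61`); with it the window theorem of the sequel reads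
`Σ_j L_j∕P_j ≤ 1∕(ρ(1 − log R∕16)) ≤ 2` iff `log R ≤ 8(2 − √2) ≈ 4.686`, `R ≤ 108.4`.  NOT CLAIMED: the conjectured threshold `133.9` — affine minorants
provably stop at `R ≈ 126` (`ψ` is concave only up to `u ≈ 2.29` and the best line through `(0,ρ)` has midpoint value `½` at `ℓ = 4.836`); a PSD certificate
for `ψ` (it IS positive definite: `1∕√(j+k)` is a Gamma integral) together with the chord inequality `ψ(s) + ψ(ℓ−s) ≥ ψ(0) + ψ(ℓ)` (numerically true up
to `ℓ ≈ log 300`) would give the sharp `2∕(ρ + σ(R))`; census in `HOME/b2b-balaban-beta-d4-p3/g101/`.  Nothing printed is asserted.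

WHAT IS PROVED ([folklore]; 0 `def`, 0 sorry; Mathlib only).  §1 `two_mul_sqrt_mul_le`, **`energy_le_sum`**.  §2 `mul_abs_sub_add_mul_le`, **`sum_mul_abs_sub_le`**,
**`sum_div_le_inv_of_affine_minorant`**.  §3 `two_terms_le_log`, `poly_cert_nonneg`, **`sqrt_half_mul_le_sqrt_geomRead`**, **`sqrt_half_mul_le_geomRead`**.
-/
noncomputable section
open Finset Set

namespace Summit.QuantumFields.BalabanUV.Beta.EriceRemainderEnclosureHistoryAutonomyComparisonKernelEnergy

/-! ## §1 The Perron sandwich `Σ_{i,j} √(a_ij a_ji)·f_i f_j ≤ Σ_j f_j` for `f_j = L_j ∕ P_j`, `P_j = Σ_k L_k a_jk` -/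

/-- AM–GM with the geometric mean of two reads: `2√(s s′)·x·y ≤ s·x² + s′·y²` (`s, s′ ≥ 0`). [folklore] -/
theorem two_mul_sqrt_mul_le {s s' : ℝ} (hs : 0 ≤ s) (hs' : 0 ≤ s') (x y : ℝ) :
    2 * Real.sqrt (s * s') * x * y ≤ s * x ^ 2 + s' * y ^ 2 := by
  calc 2 * Real.sqrt (s * s') * x * y = 2 * (Real.sqrt s * x) * (Real.sqrt s' * y) := by
        rw [Real.sqrt_mul hs]; ring
    _ ≤ (Real.sqrt s * x) ^ 2 + (Real.sqrt s' * y) ^ 2 := two_mul_le_add_sq _ _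
    _ = s * x ^ 2 + s' * y ^ 2 := by rw [mul_pow, mul_pow, Real.sq_sqrt hs, Real.sq_sqrt hs']

/-- **THE PERRON SANDWICH.**  For a non-negative kernel `a` on a finite index set, weights `L ≥ 0` and the reads `P_i = Σ_k L_k·a_ik`, the
loads `f_i = L_i ∕ P_i` satisfy `Σ_{i,j} √(a_ij·a_ji)·f_i·f_j ≤ Σ_j f_j`: termwise AM–GM `2√(a_ij a_ji)∕(P_iP_j) ≤ a_ij∕P_i² + a_ji∕P_j²`, and
`Σ_j a_ij L_j = P_i` (the vector `L` is a POSITIVE eigenvector of `diag(1∕P)·a`, so the symmetrised kernel has top eigenvalue `1` in the loads'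
metric; Lean's `x ∕ 0 = 0` makes indices with `P_i = 0` harmless). [folklore] -/
theorem energy_le_sum {ι : Type*} {S : Finset ι} {a : ι → ι → ℝ} {L P : ι → ℝ} (ha : ∀ i j, 0 ≤ a i j) (hL : ∀ i, 0 ≤ L i)
    (hP : ∀ i, P i = ∑ k ∈ S, L k * a i k) :
    ∑ i ∈ S, ∑ j ∈ S, Real.sqrt (a i j * a j i) * (L i / P i) * (L j / P j) ≤ ∑ j ∈ S, L j / P j := by
  have hterm : ∀ i j, Real.sqrt (a i j * a j i) * (L i / P i) * (L j / P j)
      ≤ (1 / 2) * (L i / P i ^ 2 * (L j * a i j)) + (1 / 2) * (L j / P j ^ 2 * (L i * a j i)) := by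
    intro i j
    have key := two_mul_sqrt_mul_le (ha i j) (ha j i) (1 / P i) (1 / P j)
    have hLL : 0 ≤ L i * L j := mul_nonneg (hL i) (hL j)
    have e1 : Real.sqrt (a i j * a j i) * (L i / P i) * (L j / P j)
        = (L i * L j) * ((2 * Real.sqrt (a i j * a j i) * (1 / P i) * (1 / P j)) / 2) := by ring
    have e2 : (1 / 2) * (L i / P i ^ 2 * (L j * a i j)) + (1 / 2) * (L j / P j ^ 2 * (L i * a j i))
        = (L i * L j) * ((a i j * (1 / P i) ^ 2 + a j i * (1 / P j) ^ 2) / 2) := by ring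
    rw [e1, e2]
    exact mul_le_mul_of_nonneg_left (by linarith) hLL
  have haux : ∀ j, L j / P j ^ 2 * P j = L j / P j := by
    intro j
    by_cases hPj : P j = 0
    · simp [hPj]
    · rw [pow_two, div_mul_eq_mul_div]
      exact mul_div_mul_right (L j) (P j) hPj
  have h1 : ∀ i, ∑ j ∈ S, (1 / 2) * (L i / P i ^ 2 * (L j * a i j)) = (1 / 2) * (L i / P i) := by
    intro i
    rw [← mul_sum, ← mul_sum, ← hP i, haux i]
  have hA : ∑ i ∈ S, ∑ j ∈ S, (1 / 2) * (L i / P i ^ 2 * (L j * a i j)) = (1 / 2) * ∑ i ∈ S, L i / P i := by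
    rw [sum_congr rfl fun i _ => h1 i, mul_sum]
  have hB : ∑ i ∈ S, ∑ j ∈ S, (1 / 2) * (L j / P j ^ 2 * (L i * a j i)) = (1 / 2) * ∑ j ∈ S, L j / P j := by
    rw [sum_comm]
    exact hA
  calc ∑ i ∈ S, ∑ j ∈ S, Real.sqrt (a i j * a j i) * (L i / P i) * (L j / P j)
      ≤ ∑ i ∈ S, ∑ j ∈ S, ((1 / 2) * (L i / P i ^ 2 * (L j * a i j)) + (1 / 2) * (L j / P j ^ 2 * (L i * a j i))) :=
        sum_le_sum fun i _ => sum_le_sum fun j _ => hterm i j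
    _ = ∑ i ∈ S, ∑ j ∈ S, (1 / 2) * (L i / P i ^ 2 * (L j * a i j))
          + ∑ i ∈ S, ∑ j ∈ S, (1 / 2) * (L j / P j ^ 2 * (L i * a j i)) := by
        rw [← sum_add_distrib]
        exact sum_congr rfl fun i _ => sum_add_distrib
    _ = ∑ j ∈ S, L j / P j := by rw [hA, hB]; ring

/-! ## §2 The line lemma and the energy bound from an affine minorant in a line coordinate -/

/-- On `[−h, h]`: `h·|α − β| + α·β ≤ h²` — for `α ≤ β` it is `(h + α)(h − β) ≥ 0`. [folklore] -/
theorem mul_abs_sub_add_mul_le {α β h : ℝ} (hα : |α| ≤ h) (hβ : |β| ≤ h) : h * |α - β| + α * β ≤ h ^ 2 := by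
  obtain ⟨hα1, hα2⟩ := abs_le.mp hα
  obtain ⟨hβ1, hβ2⟩ := abs_le.mp hβ
  rcases le_total α β with hle | hle
  · rw [abs_of_nonpos (by linarith)]
    nlinarith [mul_nonneg (show 0 ≤ h + α by linarith) (show 0 ≤ h - β by linarith)]
  · rw [abs_of_nonneg (by linarith)]
    nlinarith [mul_nonneg (show 0 ≤ h + β by linarith) (show 0 ≤ h - α by linarith)]

/-- **THE LINE LEMMA.**  Non-negative weights `f` whose support sits at points `w_i` of an interval `[c − h, c + h]` have
`Σ_{i,j} f_i f_j·|w_i − w_j| ≤ h·(Σ_i f_i)²` (the two-endpoint configuration is extremal): sum `h|α−β| + αβ ≤ h²` against `f_i f_j` and drop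
`(Σ_i f_i (w_i − c))² ≥ 0`. [folklore] -/
theorem sum_mul_abs_sub_le {ι : Type*} (S : Finset ι) (f w : ι → ℝ) {c h : ℝ} (hh : 0 ≤ h) (hf : ∀ i ∈ S, 0 ≤ f i)
    (hw : ∀ i ∈ S, 0 < f i → |w i - c| ≤ h) :
    ∑ i ∈ S, ∑ j ∈ S, f i * f j * |w i - w j| ≤ h * (∑ i ∈ S, f i) ^ 2 := by
  have hterm : ∀ i ∈ S, ∀ j ∈ S, h * (f i * f j * |w i - w j|) ≤ f i * f j * (h ^ 2 - (w i - c) * (w j - c)) := by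
    intro i hi j hj
    rcases (hf i hi).eq_or_lt with h1 | h1
    · rw [← h1]; simp
    rcases (hf j hj).eq_or_lt with h2 | h2
    · rw [← h2]; simp
    have key := mul_abs_sub_add_mul_le (hw i hi h1) (hw j hj h2)
    rw [show w i - c - (w j - c) = w i - w j by ring] at key
    calc h * (f i * f j * |w i - w j|) = f i * f j * (h * |w i - w j|) := by ring
      _ ≤ f i * f j * (h ^ 2 - (w i - c) * (w j - c)) := mul_le_mul_of_nonneg_left (by linarith) (mul_nonneg h1.le h2.le)
  have hsum : h * ∑ i ∈ S, ∑ j ∈ S, f i * f j * |w i - w j|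
      ≤ h ^ 2 * (∑ i ∈ S, f i) ^ 2 - (∑ i ∈ S, f i * (w i - c)) ^ 2 := by
    calc h * ∑ i ∈ S, ∑ j ∈ S, f i * f j * |w i - w j| = ∑ i ∈ S, ∑ j ∈ S, h * (f i * f j * |w i - w j|) := by
          rw [mul_sum]; exact sum_congr rfl fun i _ => mul_sum _ _ _
      _ ≤ ∑ i ∈ S, ∑ j ∈ S, f i * f j * (h ^ 2 - (w i - c) * (w j - c)) :=
          sum_le_sum fun i hi => sum_le_sum fun j hj => hterm i hi j hj
      _ = ∑ i ∈ S, ∑ j ∈ S, (h ^ 2 * (f i * f j) - (f i * (w i - c)) * (f j * (w j - c))) :=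
          sum_congr rfl fun i _ => sum_congr rfl fun j _ => by ring
      _ = h ^ 2 * (∑ i ∈ S, f i) ^ 2 - (∑ i ∈ S, f i * (w i - c)) ^ 2 := by
          simp only [sum_sub_distrib, ← mul_sum, pow_two, sum_mul_sum]
  have hsq : 0 ≤ (∑ i ∈ S, f i * (w i - c)) ^ 2 := sq_nonneg _
  rcases hh.eq_or_lt with h0 | hpos
  · -- `h = 0`: every supported point is `c`, every summand vanishes
    rw [← h0, zero_mul]
    refine le_of_eq (sum_eq_zero fun i hi => sum_eq_zero fun j hj => ?_)
    rcases (hf i hi).eq_or_lt with h1 | h1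
    · rw [← h1]; simp
    rcases (hf j hj).eq_or_lt with h2 | h2
    · rw [← h2]; simp
    have hi' := hw i hi h1
    have hj' := hw j hj h2
    rw [← h0] at hi' hj'
    have ei : w i = c := by linarith [abs_nonneg (w i - c), abs_eq_zero.mp (le_antisymm hi' (abs_nonneg _))]
    have ej : w j = c := by linarith [abs_nonneg (w j - c), abs_eq_zero.mp (le_antisymm hj' (abs_nonneg _))]
    rw [ei, ej]; simp
  · have : h * ∑ i ∈ S, ∑ j ∈ S, f i * f j * |w i - w j| ≤ h * (h * (∑ i ∈ S, f i) ^ 2) := by nlinarith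
    exact le_of_mul_le_mul_left this hpos

/-- **THE KERNEL ENERGY BOUND ⟹ THE LOAD SUM BOUND.**  Kernel `a ≥ 0`, weights `L ≥ 0`, reads `P_i = Σ_k L_k a_ik`, loads `f_i = L_i∕P_i`.  If on the
support of the loads the geometric reads dominate an AFFINE MINORANT IN A LINE COORDINATE, `√(a_ij a_ji) ≥ ρ′ − λ·|w_i − w_j|` with the points
`w_i` in `[c − h, c + h]` (`λ, h ≥ 0`, `m := ρ′ − λh > 0`), then **`Σ_j f_j ≤ 1∕m`**: by §1 and the line lemma `m·(Σf)² ≤ Σ_{ij} √(a_ij a_ji) f_i f_j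
≤ Σ f`. [folklore] -/
theorem sum_div_le_inv_of_affine_minorant {ι : Type*} {S : Finset ι} {a : ι → ι → ℝ} {L P w : ι → ℝ} {c h ρ' lam : ℝ}
    (ha : ∀ i j, 0 ≤ a i j) (hL : ∀ i, 0 ≤ L i) (hP : ∀ i, P i = ∑ k ∈ S, L k * a i k) (hh : 0 ≤ h) (hlam : 0 ≤ lam)
    (hm : 0 < ρ' - lam * h) (hw : ∀ i ∈ S, 0 < L i / P i → |w i - c| ≤ h)
    (hmin : ∀ i ∈ S, ∀ j ∈ S, 0 < L i / P i → 0 < L j / P j → ρ' - lam * |w i - w j| ≤ Real.sqrt (a i j * a j i)) :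
    ∑ j ∈ S, L j / P j ≤ 1 / (ρ' - lam * h) := by
  set f : ι → ℝ := fun i => L i / P i with hf
  have hP0 : ∀ i, 0 ≤ P i := fun i => by rw [hP i]; exact sum_nonneg fun k _ => mul_nonneg (hL k) (ha i k)
  have hf0 : ∀ i, 0 ≤ f i := fun i => div_nonneg (hL i) (hP0 i)
  change ∑ j ∈ S, f j ≤ 1 / (ρ' - lam * h)
  have hup : ∑ i ∈ S, ∑ j ∈ S, Real.sqrt (a i j * a j i) * f i * f j ≤ ∑ j ∈ S, f j := energy_le_sum ha hL hP
  have hlow : ∑ i ∈ S, ∑ j ∈ S, (ρ' - lam * |w i - w j|) * (f i * f j)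
      ≤ ∑ i ∈ S, ∑ j ∈ S, Real.sqrt (a i j * a j i) * f i * f j := by
    refine sum_le_sum fun i hi => sum_le_sum fun j hj => ?_
    rcases (hf0 i).eq_or_lt with h1 | h1
    · rw [← h1]; simp
    rcases (hf0 j).eq_or_lt with h2 | h2
    · rw [← h2]; simp
    rw [mul_assoc]
    exact mul_le_mul_of_nonneg_right (hmin i hi j hj h1 h2) (mul_nonneg h1.le h2.le)
  have hline := sum_mul_abs_sub_le S f w hh (fun i _ => hf0 i) hw
  have hsq : ∑ i ∈ S, ∑ j ∈ S, ρ' * (f i * f j) = ρ' * (∑ i ∈ S, f i) ^ 2 := by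
    rw [pow_two, sum_mul_sum, mul_sum]
    exact sum_congr rfl fun i _ => by rw [mul_sum]
  have hlm : ∑ i ∈ S, ∑ j ∈ S, lam * (f i * f j * |w i - w j|) = lam * ∑ i ∈ S, ∑ j ∈ S, f i * f j * |w i - w j| := by
    rw [mul_sum]
    exact sum_congr rfl fun i _ => by rw [mul_sum]
  have hsplit : ∑ i ∈ S, ∑ j ∈ S, (ρ' - lam * |w i - w j|) * (f i * f j)
      = ρ' * (∑ i ∈ S, f i) ^ 2 - lam * ∑ i ∈ S, ∑ j ∈ S, f i * f j * |w i - w j| := by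
    rw [← hsq, ← hlm, ← sum_sub_distrib]
    refine sum_congr rfl fun i _ => ?_
    rw [← sum_sub_distrib]
    exact sum_congr rfl fun j _ => by ring
  set T : ℝ := ∑ i ∈ S, f i with hT
  have hT0 : 0 ≤ T := sum_nonneg fun i _ => hf0 i
  have hchain : (ρ' - lam * h) * T ^ 2 ≤ T := by
    have := mul_le_mul_of_nonneg_left hline hlam
    nlinarith
  rcases hT0.eq_or_lt with hT1 | hTpos
  · rw [← hT1]; positivity
  · rw [le_div_iff₀ hm]
    nlinarith

/-! ## §3 The affine-in-log minorant of the geometric read of the age kernel: `t^{1∕4}∕√(1+t) ≥ ρ·(1 − (log t)∕8)`, `ρ = √(1∕2)` -/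

/-- Two terms of the artanh series bound the logarithm from below: `2y + ⅔·y³ ≤ log z` for `z ≥ 1`, `y = (z − 1)∕(z + 1)` (Mathlib's
`Real.hasSum_log_sub_log_of_abs_lt_one`; every term of the series is non-negative). [folklore] -/
theorem two_terms_le_log {z : ℝ} (hz : 1 ≤ z) :
    2 * ((z - 1) / (z + 1)) + 2 / 3 * ((z - 1) / (z + 1)) ^ 3 ≤ Real.log z := by
  set x : ℝ := (z - 1) / (z + 1) with hx
  have hz1 : 0 < z + 1 := by linarith
  have hx0 : 0 ≤ x := div_nonneg (by linarith) hz1.le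
  have hx1 : x < 1 := (div_lt_one hz1).2 (by linarith)
  have habs : |x| < 1 := by rw [abs_of_nonneg hx0]; exact hx1
  have h1 : 1 + x = 2 * z / (z + 1) := by rw [hx]; field_simp; ring
  have h2 : 1 - x = 2 / (z + 1) := by rw [hx]; field_simp; ring
  have hT : Real.log (1 + x) - Real.log (1 - x) = Real.log z := by
    rw [h1, h2, ← Real.log_div (by positivity) (by positivity)]
    congr 1
    field_simp
  set g : ℕ → ℝ := fun k => (2 : ℝ) * (1 / (2 * k + 1)) * x ^ (2 * k + 1) with hg
  have hsum : HasSum g (Real.log z) := hT ▸ Real.hasSum_log_sub_log_of_abs_lt_one habs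
  have hg0 : ∀ k, 0 ≤ g k := fun k => by simp only [hg]; positivity
  have hle : ∑ k ∈ range 2, g k ≤ Real.log z := sum_le_hasSum (range 2) (fun k _ => hg0 k) hsum
  have e : ∑ k ∈ range 2, g k = 2 * x + 2 / 3 * x ^ 3 := by
    simp only [hg, sum_range_succ, sum_range_zero]
    norm_num
  linarith

/-- The polynomial certificate behind the minorant: `G(y) = 18 − 81y + 114y² − 60y³ + 54y⁴ − 46y⁵ + 6y⁶ − 12y⁷ − y⁹ ≥ 0` on `[0, 41∕50]` — on each
of `[0, 49∕100]`, `[49∕100, 1∕2]`, `[1∕2, 41∕50]` every BERNSTEIN coefficient of `G` is positive (least `≈ 0.43`), so each piece is a non-negative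
combination of the ten products `(y − lo)^k·(hi − y)^{9−k}`. [folklore] -/
theorem poly_cert_nonneg {y : ℝ} (h0 : 0 ≤ y) (h1 : y ≤ 41 / 50) :
    0 ≤ 18 - 81 * y + 114 * y ^ 2 - 60 * y ^ 3 + 54 * y ^ 4 - 46 * y ^ 5 + 6 * y ^ 6 - 12 * y ^ 7 - y ^ 9 := by
  rcases le_or_gt y (49 / 100) with ha | ha
  · have hv : 0 ≤ 49 / 100 - y := by linarith
    linarith [mul_nonneg (pow_nonneg h0 0) (pow_nonneg hv 9), mul_nonneg (pow_nonneg h0 1) (pow_nonneg hv 8),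
      mul_nonneg (pow_nonneg h0 2) (pow_nonneg hv 7), mul_nonneg (pow_nonneg h0 3) (pow_nonneg hv 6),
      mul_nonneg (pow_nonneg h0 4) (pow_nonneg hv 5), mul_nonneg (pow_nonneg h0 5) (pow_nonneg hv 4),
      mul_nonneg (pow_nonneg h0 6) (pow_nonneg hv 3), mul_nonneg (pow_nonneg h0 7) (pow_nonneg hv 2),
      mul_nonneg (pow_nonneg h0 8) (pow_nonneg hv 1), mul_nonneg (pow_nonneg h0 9) (pow_nonneg hv 0)]
  rcases le_or_gt y (1 / 2) with hb | hb
  · have hu : 0 ≤ y - 49 / 100 := by linarith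
    have hv : 0 ≤ 1 / 2 - y := by linarith
    linarith [mul_nonneg (pow_nonneg hu 0) (pow_nonneg hv 9), mul_nonneg (pow_nonneg hu 1) (pow_nonneg hv 8),
      mul_nonneg (pow_nonneg hu 2) (pow_nonneg hv 7), mul_nonneg (pow_nonneg hu 3) (pow_nonneg hv 6),
      mul_nonneg (pow_nonneg hu 4) (pow_nonneg hv 5), mul_nonneg (pow_nonneg hu 5) (pow_nonneg hv 4),
      mul_nonneg (pow_nonneg hu 6) (pow_nonneg hv 3), mul_nonneg (pow_nonneg hu 7) (pow_nonneg hv 2),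
      mul_nonneg (pow_nonneg hu 8) (pow_nonneg hv 1), mul_nonneg (pow_nonneg hu 9) (pow_nonneg hv 0)]
  · have hu : 0 ≤ y - 1 / 2 := by linarith
    have hv : 0 ≤ 41 / 50 - y := by linarith
    linarith [mul_nonneg (pow_nonneg hu 0) (pow_nonneg hv 9), mul_nonneg (pow_nonneg hu 1) (pow_nonneg hv 8),
      mul_nonneg (pow_nonneg hu 2) (pow_nonneg hv 7), mul_nonneg (pow_nonneg hu 3) (pow_nonneg hv 6),
      mul_nonneg (pow_nonneg hu 4) (pow_nonneg hv 5), mul_nonneg (pow_nonneg hu 5) (pow_nonneg hv 4),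
      mul_nonneg (pow_nonneg hu 6) (pow_nonneg hv 3), mul_nonneg (pow_nonneg hu 7) (pow_nonneg hv 2),
      mul_nonneg (pow_nonneg hu 8) (pow_nonneg hv 1), mul_nonneg (pow_nonneg hu 9) (pow_nonneg hv 0)]

/-- **THE MINORANT IN THE RATIO**: `√(1∕2)·(1 − (log t)∕8) ≤ √(√t ∕ (1 + t))` for every `t ≥ 1` — the geometric read `t^{1∕4}∕√(1+t)` of two ages at
ratio `t` lies above the line of slope `−ρ∕8` through its value `ρ = √(1∕2)` at `t = 1`, in the coordinate `log t` (tangency `≈ 3 %` short near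
`t ≈ 60`; the critical slope is `≈ 0.1211·ρ`).  Proof: `z = t^{1∕4}`, `y = (z−1)∕(z+1)`; `log t = 4 log z ≥ 8y + (8∕3)y³` (§3 `two_terms_le_log`), so
`1 − (log t)∕8 ≤ q := 1 − y − y³∕3`; if `q ≤ 0` there is nothing to prove, else `y ≤ 41∕50` and `½q² ≤ z²∕(1+z⁴) = (1−y²)²∕(2(1+6y²+y⁴))` is
`y·G(y) ≥ 0` (`poly_cert_nonneg`). [folklore] -/
theorem sqrt_half_mul_le_sqrt_geomRead {t : ℝ} (ht : 1 ≤ t) :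
    Real.sqrt (1 / 2) * (1 - Real.log t / 8) ≤ Real.sqrt (Real.sqrt t / (1 + t)) := by
  rcases le_or_gt (1 - Real.log t / 8) 0 with hneg | hpos
  · exact le_trans (mul_nonpos_of_nonneg_of_nonpos (Real.sqrt_nonneg _) hneg) (Real.sqrt_nonneg _)
  have ht0 : 0 < t := by linarith
  set z : ℝ := Real.sqrt (Real.sqrt t) with hz
  have hst1 : 1 ≤ Real.sqrt t := by rw [← Real.sqrt_one]; exact Real.sqrt_le_sqrt ht
  have hz1 : 1 ≤ z := by rw [hz, ← Real.sqrt_one]; exact Real.sqrt_le_sqrt hst1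
  have hz0 : 0 < z := by linarith
  have hz2 : z ^ 2 = Real.sqrt t := by rw [hz, Real.sq_sqrt (Real.sqrt_nonneg _)]
  have hz4 : z ^ 4 = t := by rw [show z ^ 4 = (z ^ 2) ^ 2 by ring, hz2, Real.sq_sqrt ht0.le]
  have hlogt : Real.log t = 4 * Real.log z := by rw [← hz4, Real.log_pow]; norm_num
  set y : ℝ := (z - 1) / (z + 1) with hy
  have hy0 : 0 ≤ y := div_nonneg (by linarith) (by linarith)
  have hy1 : y < 1 := (div_lt_one (by linarith)).2 (by linarith)
  have hlogz := two_terms_le_log hz1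
  have hq : 1 - Real.log t / 8 ≤ 1 - y - y ^ 3 / 3 := by rw [hlogt]; linarith
  have hy41 : y ≤ 41 / 50 := by
    rcases le_or_gt y (41 / 50) with h41 | hcon
    · exact h41
    have h3 : (41 / 50 : ℝ) ^ 3 ≤ y ^ 3 := pow_le_pow_left₀ (by norm_num) hcon.le 3
    linarith
  have hL0 : 0 ≤ Real.sqrt (1 / 2) * (1 - Real.log t / 8) := mul_nonneg (Real.sqrt_nonneg _) hpos.le
  rw [Real.le_sqrt hL0 (by positivity), mul_pow, Real.sq_sqrt (by norm_num : (0 : ℝ) ≤ 1 / 2)]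
  have hq2 : (1 - Real.log t / 8) ^ 2 ≤ (1 - y - y ^ 3 / 3) ^ 2 := pow_le_pow_left₀ hpos.le hq 2
  have hz_y : z = (1 + y) / (1 - y) := by
    have h1y : (1 : ℝ) - y ≠ 0 := by linarith
    rw [eq_div_iff h1y, hy]
    field_simp
    ring
  have hval : Real.sqrt t / (1 + t) = (1 - y ^ 2) ^ 2 / (2 * (1 + 6 * y ^ 2 + y ^ 4)) := by
    rw [← hz2, ← hz4, hz_y]
    have h1y : (1 : ℝ) - y ≠ 0 := by linarith
    field_simp
    ring
  rw [hval, le_div_iff₀ (by positivity)]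
  have hkey : (1 - y - y ^ 3 / 3) ^ 2 * (1 + 6 * y ^ 2 + y ^ 4) ≤ (1 - y ^ 2) ^ 2 := by
    have := mul_nonneg hy0 (poly_cert_nonneg hy0 hy41)
    nlinarith [this]
  have hB0 : 0 ≤ 1 + 6 * y ^ 2 + y ^ 4 := by positivity
  nlinarith [mul_le_mul_of_nonneg_right hq2 hB0]

/-- **THE AFFINE-IN-log MINORANT OF THE GEOMETRIC READ** (two ages `0 < a`, `0 < b`): `√(1∕2)·(1 − |log a − log b|∕8) ≤ √(√(a∕(a+b))·√(b∕(b+a)))`,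
i.e. `σ_ab = (ab)^{1∕4}∕√(a+b) ≥ ρ − (ρ∕8)·|log a − log b|` — the hypothesis `hmin` of §2 `sum_div_le_inv_of_affine_minorant` for the age kernel
`s_jk = √(j∕(j+k))` in the coordinate `w = log`. [folklore] -/
theorem sqrt_half_mul_le_geomRead {a b : ℝ} (ha : 0 < a) (hb : 0 < b) :
    Real.sqrt (1 / 2) * (1 - |Real.log a - Real.log b| / 8)
      ≤ Real.sqrt (Real.sqrt (a / (a + b)) * Real.sqrt (b / (b + a))) := by
  -- the product of the two reads depends on the ratio only
  have hprod : ∀ {a b : ℝ}, 0 < a → 0 < b →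
      Real.sqrt (a / (a + b)) * Real.sqrt (b / (b + a)) = Real.sqrt (b / a) / (1 + b / a) := by
    intro a b ha hb
    rw [← Real.sqrt_mul (div_nonneg ha.le (by positivity))]
    have e : a / (a + b) * (b / (b + a)) = (b / a) / (1 + b / a) ^ 2 := by field_simp; ring
    rw [e, Real.sqrt_div' _ (by positivity), Real.sqrt_sq (by positivity)]
  rcases le_total a b with hab | hba
  · have hlog : |Real.log a - Real.log b| = Real.log (b / a) := by
      rw [abs_sub_comm, Real.log_div hb.ne' ha.ne']
      exact abs_of_nonneg (by linarith [Real.log_le_log ha hab])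
    rw [hlog, hprod ha hb]
    exact sqrt_half_mul_le_sqrt_geomRead ((one_le_div ha).2 hab)
  · have hlog : |Real.log a - Real.log b| = Real.log (a / b) := by
      rw [Real.log_div ha.ne' hb.ne']
      exact abs_of_nonneg (by linarith [Real.log_le_log hb hba])
    rw [hlog, mul_comm (Real.sqrt (a / (a + b))), hprod hb ha]
    exact sqrt_half_mul_le_sqrt_geomRead ((one_le_div hb).2 hba)

end Summit.QuantumFields.BalabanUV.Beta.EriceRemainderEnclosureHistoryAutonomyComparisonKernelEnergy

end
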